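import Summits.AnomalousDissipation.AnomalousDissipation.Theorems.SawtoothPulseCascadeK1LocalisedCascadeWindowBlockCTS
import Summits.AnomalousDissipation.AnomalousDissipation.Theorems.SawtoothPulseCascadeK1LocalisedCascadeClassStepOsc

/-!
# K1loc, line `Spectral` — helper: THE CORNER-TRACE WINDOW BLOCKS FOR THE ITERATES, SIGN-SPLIT TRACES (S-D, A24-2)

Sign-split twins of `…ClassStepCT.sum_window_iterate_{v,h}step_ct_le`: the window-block lemmas
`…WindowBlockCTS.sum_windowBlock_{v,h}step_ct_split_le` applied to the cascade iterates `b_j ↦ a_{j+1}` (V-step) and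
`a_j ↦ b_j` (H-step); the block data (`χ`, `p`, `D_m`, `M_c`, `E`, `M`, `η`, and the corner traces `Θ⁺, Θ⁻` split by the
sign of the fibre index) pass through unchanged.  Trace term of the junk: `3N_jσ/π²·2N_j(Θ⁺ + Θ⁻)`.
-/

-- `Summit.<Summit>.<Problem>`: single-conjunct summit, the duplicate namespace segment is deliberate.
set_option linter.dupNamespace false

namespace Summit.AnomalousDissipation.AnomalousDissipation.Theorems.SawtoothPulseCascade.K1Window

open MeasureTheory Set Filter Topology UnitAddTorus Function Complex Metric
open scoped Real ENNReal
open Literature.Analysis Literature.Analysis.FunctionSpaces Literature.Analysis.FunctionSpaces.Torus Literature.Analysis.FluidPDE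
open Literature.Analysis.FluidPDE.ShearStage
open Literature.Analysis.FluidPDE.SawtoothCascade Literature.Analysis.FluidPDE.SawtoothCascade.CascadeParams
open Summit.AnomalousDissipation.AnomalousDissipation.Theorems.SawtoothPulseCascade.K1Start
open Summit.AnomalousDissipation.AnomalousDissipation.Theorems.SawtoothPulseCascade.K1Flat
open Summit.AnomalousDissipation.AnomalousDissipation.Theorems.SawtoothPulseCascade.K1Ledger.From

section Cascade

variable (P : CascadeParams)

/-- **CT V window block for the cascade iterates, sign-split traces**: `…WindowBlockCTS.sum_windowBlock_vstep_ct_split_le` applied to `b = b_j`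
(smooth, summable Fourier coefficients), whose shear image is `a_{j+1}`. [cite: Grafakos2014, Prop. 3.1.2 (5), Prop. 3.2.7 (3)] -/
theorem sum_window_iterate_vstep_ct_split_le {G : ℕ} (hγ : P.γ = G) (hδ₀ : 0 < P.δ₀) (hd : 0 < P.d) (hN₀ : 1 ≤ P.N₀)
    (hρN : 1 ≤ P.ρN) (a b : ℕ → UnitAddTorus (Fin 2) → ℝ) (has : ∀ j, IsSmooth (a j))
    (hb : ∀ j, b j = a j ∘ shearMap 0 1 (amp ⟨P.U j, P.U_periodic j, P.contDiff_U (P.δ_pos hδ₀ hd j)⟩ P.γ))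
    (hab : ∀ j, a (j + 1) = b j ∘ shearMap 1 0 (amp ⟨P.U j, P.U_periodic j, P.contDiff_U (P.δ_pos hδ₀ hd j)⟩ P.γ))
    (j : ℕ) {Q₁ Q₂ Λ Λ' Dm : ℕ} (χ : ℤ → ℂ) (hχS : ∀ l, l ∉ Finset.Icc (-(Q₂ : ℤ)) Q₂ → χ l = 0)
    (hχr : ∀ l, ∃ r : ℝ, 0 ≤ r ∧ r ≤ 1 ∧ χ l = (r : ℂ)) (hχ1 : ∀ l : ℤ, |l| ≤ Q₁ → χ l = 1) (p : ℤ → ℕ)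
    (W : Finset (Fin 2 → ℤ)) (hW : ∀ k ∈ W, (Λ : ℤ) ≤ |k 1| ∧ |k 1| ≤ Λ')
    (hWp : ∀ k ∈ W, |k 0| + Q₂ ≤ (p (k 1) : ℤ)) (hDm : 0 < Dm) (hD : ∀ k ∈ W, (p (k 1) : ℤ) + Dm ≤ |k 1| * G)
    {Mc : ℝ} (hMc : ∀ k : ℤ, ((((Finset.Icc (-(Q₂ : ℤ)) Q₂).filter fun l => (P.N j : ℤ) ∣ k - l).card : ℕ) : ℝ) ≤ Mc)
    {Θp Θm E M η : ℝ} (hΘp : ∀ y : ℝ, ∑ n ∈ (W.image (fun k => k 1)).filter (fun n => 0 < n),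
      ‖∑ l ∈ Finset.Icc (-(Q₂ : ℤ)) Q₂, χ l * mFourierCoeff (fun x => (b j x : ℂ)) ![l, n] *
        cexp (2 * π * I * l * y)‖ ^ 2 ≤ Θp)
    (hΘm : ∀ y : ℝ, ∑ n ∈ (W.image (fun k => k 1)).filter (fun n => n < 0),
      ‖∑ l ∈ Finset.Icc (-(Q₂ : ℤ)) Q₂, χ l * mFourierCoeff (fun x => (b j x : ℂ)) ![l, n] *
        cexp (2 * π * I * l * y)‖ ^ 2 ≤ Θm)
    (hE : ∑ n ∈ W.image (fun k => k 1), ∑ l ∈ Finset.Icc (-(Q₂ : ℤ)) Q₂,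
      ‖χ l * mFourierCoeff (fun x => (b j x : ℂ)) ![l, n]‖ ^ 2 ≤ E)
    (hM : 1 ≤ M) (hMδ : M * P.δ j < π / 2)
    (hη : 2 * π * ((Λ' * G : ℕ) : ℝ) * (Real.exp (-(M ^ 2 / 2)) / (2 * P.N j)) ≤ η) :
    ∑ k ∈ W, ‖mFourierCoeff (fun x => (a (j + 1) x : ℂ)) k‖ ^ 2 ≤
      (Real.sqrt (3 * P.N j * (1 / ((Dm : ℝ) + Q₂) ^ 2 + 1 / (P.N j * ((Dm : ℝ) + Q₂))) / π ^ 2 * (2 * P.N j * (Θp + Θm)) +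
            12 * (P.N j : ℝ) ^ 2 * (Q₂ : ℝ) ^ 2 * Mc * (1 / ((Dm : ℝ) + Q₂) ^ 2 + 1 / (P.N j * ((Dm : ℝ) + Q₂))) /
              (π ^ 2 * (Dm : ℝ) ^ 2) * E) +
          Real.sqrt (η ^ 2 * E + 8 * M * P.δ j / π * (Θp + Θm)) +
        Real.sqrt (∑' k : Fin 2 → ℤ, (if (Λ : ℤ) ≤ |k 1| ∧ |k 1| ≤ Λ' ∧ (Q₁ : ℤ) < |k 0| then (1 : ℝ) else 0) *
          ‖mFourierCoeff (fun x => (b j x : ℂ)) k‖ ^ 2)) ^ 2 := by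
  set Ψ : ShearProfile := amp ⟨P.U j, P.U_periodic j, P.contDiff_U (P.δ_pos hδ₀ hd j)⟩ P.γ with hΨ
  set bC : UnitAddTorus (Fin 2) → ℂ := fun x => (b j x : ℂ) with hbC
  have hbs : IsSmooth (b j) := isSmooth_b P hδ₀ hd a b has hb j
  have hbc : Continuous bC := Complex.continuous_ofReal.comp hbs.continuous
  have hbsum : Summable fun k => ‖mFourierCoeff bC k‖ := summable_norm_mFourierCoeff_ofReal_of_isSmooth hbs
  have haC' : (fun x => (a (j + 1) x : ℂ)) = bC ∘ shearMap 1 0 Ψ := by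
    show (fun x => (a (j + 1) x : ℂ)) = (fun x => (b j x : ℂ)) ∘ shearMap 1 0 Ψ
    rw [hab j]; rfl
  rw [haC']
  exact sum_windowBlock_vstep_ct_split_le P hγ hδ₀ hd hN₀ hρN j hbc hbsum χ hχS hχr hχ1 p W hW hWp hDm hD hMc hΘp hΘm hE hM hMδ hη

/-- **CT H window block for the cascade iterates, sign-split traces**: `…WindowBlockCTS.sum_windowBlock_hstep_ct_split_le` applied to `a = a_j`
(smooth, summable Fourier coefficients), whose shear image is `b_j`. [cite: Grafakos2014, Prop. 3.1.2 (5), Prop. 3.2.7 (3)] -/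
theorem sum_window_iterate_hstep_ct_split_le {G : ℕ} (hγ : P.γ = G) (hδ₀ : 0 < P.δ₀) (hd : 0 < P.d) (hN₀ : 1 ≤ P.N₀)
    (hρN : 1 ≤ P.ρN) (a b : ℕ → UnitAddTorus (Fin 2) → ℝ) (has : ∀ j, IsSmooth (a j))
    (hb : ∀ j, b j = a j ∘ shearMap 0 1 (amp ⟨P.U j, P.U_periodic j, P.contDiff_U (P.δ_pos hδ₀ hd j)⟩ P.γ))
    (j : ℕ) {Q₁ Q₂ Λ Λ' Dm : ℕ} (χ : ℤ → ℂ) (hχS : ∀ l, l ∉ Finset.Icc (-(Q₂ : ℤ)) Q₂ → χ l = 0)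
    (hχr : ∀ l, ∃ r : ℝ, 0 ≤ r ∧ r ≤ 1 ∧ χ l = (r : ℂ)) (hχ1 : ∀ l : ℤ, |l| ≤ Q₁ → χ l = 1) (p : ℤ → ℕ)
    (W : Finset (Fin 2 → ℤ)) (hW : ∀ k ∈ W, (Λ : ℤ) ≤ |k 0| ∧ |k 0| ≤ Λ')
    (hWp : ∀ k ∈ W, |k 1| + Q₂ ≤ (p (k 0) : ℤ)) (hDm : 0 < Dm) (hD : ∀ k ∈ W, (p (k 0) : ℤ) + Dm ≤ |k 0| * G)
    {Mc : ℝ} (hMc : ∀ k : ℤ, ((((Finset.Icc (-(Q₂ : ℤ)) Q₂).filter fun l => (P.N j : ℤ) ∣ k - l).card : ℕ) : ℝ) ≤ Mc)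
    {Θp Θm E M η : ℝ} (hΘp : ∀ y : ℝ, ∑ n ∈ (W.image (fun k => k 0)).filter (fun n => 0 < n),
      ‖∑ l ∈ Finset.Icc (-(Q₂ : ℤ)) Q₂, χ l * mFourierCoeff (fun x => (a j x : ℂ)) ![n, l] *
        cexp (2 * π * I * l * y)‖ ^ 2 ≤ Θp)
    (hΘm : ∀ y : ℝ, ∑ n ∈ (W.image (fun k => k 0)).filter (fun n => n < 0),
      ‖∑ l ∈ Finset.Icc (-(Q₂ : ℤ)) Q₂, χ l * mFourierCoeff (fun x => (a j x : ℂ)) ![n, l] *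
        cexp (2 * π * I * l * y)‖ ^ 2 ≤ Θm)
    (hE : ∑ n ∈ W.image (fun k => k 0), ∑ l ∈ Finset.Icc (-(Q₂ : ℤ)) Q₂,
      ‖χ l * mFourierCoeff (fun x => (a j x : ℂ)) ![n, l]‖ ^ 2 ≤ E)
    (hM : 1 ≤ M) (hMδ : M * P.δ j < π / 2)
    (hη : 2 * π * ((Λ' * G : ℕ) : ℝ) * (Real.exp (-(M ^ 2 / 2)) / (2 * P.N j)) ≤ η) :
    ∑ k ∈ W, ‖mFourierCoeff (fun x => (b j x : ℂ)) k‖ ^ 2 ≤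
      (Real.sqrt (3 * P.N j * (1 / ((Dm : ℝ) + Q₂) ^ 2 + 1 / (P.N j * ((Dm : ℝ) + Q₂))) / π ^ 2 * (2 * P.N j * (Θp + Θm)) +
            12 * (P.N j : ℝ) ^ 2 * (Q₂ : ℝ) ^ 2 * Mc * (1 / ((Dm : ℝ) + Q₂) ^ 2 + 1 / (P.N j * ((Dm : ℝ) + Q₂))) /
              (π ^ 2 * (Dm : ℝ) ^ 2) * E) +
          Real.sqrt (η ^ 2 * E + 8 * M * P.δ j / π * (Θp + Θm)) +
        Real.sqrt (∑' k : Fin 2 → ℤ, (if (Λ : ℤ) ≤ |k 0| ∧ |k 0| ≤ Λ' ∧ (Q₁ : ℤ) < |k 1| then (1 : ℝ) else 0) *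
          ‖mFourierCoeff (fun x => (a j x : ℂ)) k‖ ^ 2)) ^ 2 := by
  set Ψ : ShearProfile := amp ⟨P.U j, P.U_periodic j, P.contDiff_U (P.δ_pos hδ₀ hd j)⟩ P.γ with hΨ
  set aC : UnitAddTorus (Fin 2) → ℂ := fun x => (a j x : ℂ) with haC
  have has' : IsSmooth (a j) := has j
  have hac : Continuous aC := Complex.continuous_ofReal.comp has'.continuous
  have hasum : Summable fun k => ‖mFourierCoeff aC k‖ := summable_norm_mFourierCoeff_ofReal_of_isSmooth has'
  have hbC' : (fun x => (b j x : ℂ)) = aC ∘ shearMap 0 1 Ψ := by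
    show (fun x => (b j x : ℂ)) = (fun x => (a j x : ℂ)) ∘ shearMap 0 1 Ψ
    rw [hb j]; rfl
  rw [hbC']
  exact sum_windowBlock_hstep_ct_split_le P hγ hδ₀ hd hN₀ hρN j hac hasum χ hχS hχr hχ1 p W hW hWp hDm hD hMc hΘp hΘm hE hM hMδ hη

end Cascade

end Summit.AnomalousDissipation.AnomalousDissipation.Theorems.SawtoothPulseCascade.K1Window
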